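import Summits.BirchSwinnertonDyer.BirchSwinnertonDyer.Theorems.PrintX11aMultAtkinLehnerPeriods
import Summits.BirchSwinnertonDyer.Rank1Residual.ManinAdditive.ShimuraIndexSignLaws
import Literature.NumberTheory.EllipticCurves.AtkinLehnerInvolutionsProofs
import HarnessLib

/-!
# THEOREM AL (E-es-71 `AtkinLehnerShimuraSignLaw`): an odd prime in the Shimura index forces EXACTLY ONE Atkin–Lehner sign `−1`

Summit `BirchSwinnertonDyer`, sub-problem `BirchSwinnertonDyer`, route `ManinLocalTwoThree`; width seat `bsd-line-manin23-p2`
(gen 9), `--supports` the crux C3 `ManinPrimeToThreeAtNine` (stmt-BirchSwinnertonDyer-22968).  Cell `bsd-f2-manin`, es lens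
(es g20 MEMO-es §33.4, leaf `…ManinAdditive.ShimuraIndexSignLaws`, «typed as a law»), used by an's Shimura-exclusion sieve
(MEMO-an §68, E-an-124).  `Λ₀ = periodLattice f`, `Λ₁ = periodLatticeGamma1 f`, `ξ(γ) = {∞, γ∞}_f`.

MECHANISM (character-free form of es's argument).  (1) The class of `ξ(γ)` mod `Λ₁` depends only on `d_γ mod N` (tree
`cuspSymbol_sub_mem_periodLatticeGamma1_of_apply_eq`) and is additive in `γ` (`cuspSymbol_mul`).  (2) For `Q = q^{v_q(N)}` and
`γ′ W_Q = W_Q γ` (tree `MultAL.exists_conj_alWInt`): `ξ(γ′) = ε_Q ξ(γ)` (tree `MultAL.cuspSymbol_eq_mul_of_conj_alWInt`) and —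
proved here — `d_{γ′} ≡ a_γ (mod Q)`, `d_{γ′} ≡ d_γ (mod N/Q)` (Atkin–Li).  (3) Hence: if `ε_Q = +1` and `d_γ ≡ 1 (mod N/Q)`
then `d_{γ′} ≡ d_{γ⁻¹} (mod N)`, so `ε ξ(γ) ≡ −ξ(γ)` and `2ξ(γ) ∈ Λ₁`; if `ε_Q = −1` and `d_γ ≡ 1 (mod Q)` then `d_{γ′} ≡ d_γ`,
so `−ξ(γ) ≡ ξ(γ)` and again `2ξ(γ) ∈ Λ₁`.  (4) CRT induction over the prime factors: if `2ξ(γ) ∈ Λ₁` for every `q ∣ N` and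
every `γ` with `d_γ ≡ 1 (mod N/Q_q)`, then `2ξ(γ) ∈ Λ₁` for all `γ`, i.e. `2Λ₀ ⊆ Λ₁`.  (5) If NO prime or AT LEAST TWO primes
have sign `−1`, (3) feeds (4) at every `q`; then an `x ∈ Λ₀ ∖ Λ₁` with `p x ∈ Λ₁`, `p` odd, contradicts Bézout.

PROVED here (no `sorry`): `apply_one_one_of_conj_alWInt` (Atkin–Li `d`-bookkeeping), `exists_gamma0_apply_one_one_eq_int`,
`cuspSymbol_mem_of_apply_one_one_eq_one`, `two_mul_cuspSymbol_mem_of_sign` ((3)), `two_mul_cuspSymbol_mem_of_components` ((4)),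
**`atkinLehnerShimuraSignLaw_holds : AtkinLehnerShimuraSignLaw`** (E-es-71 BY NAME).

Elementary given the tree's Atkin–Lehner period calculus.  BSD is not proved by this; Manin's conjecture is not proved by this.
-/

set_option autoImplicit false
set_option linter.dupNamespace false

noncomputable section

open scoped MatrixGroups ModularForm ComplexConjugate
open CongruenceSubgroup Matrix.SpecialLinearGroup
open Literature.NumberTheory.EllipticCurves Literature.NumberTheory.EllipticCurves.ModularForms
open Summit.BirchSwinnertonDyer.Rank1Residual.ManinAdditive
open Summit.BirchSwinnertonDyer.Rank1Residual.ManinAdditive.KatoCurve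
open Summit.BirchSwinnertonDyer.BirchSwinnertonDyer.Theorems

namespace Summit.BirchSwinnertonDyer.BirchSwinnertonDyer.Theorems.ManinLocalTwoThree

variable {N : ℕ} [NeZero N]

/-! ### Atkin–Li bookkeeping: the `d`-entry of `W_Q γ W_Q⁻¹` -/

omit [NeZero N] in
/-- For `γ, γ′ ∈ Γ₀(N)` with `γ′ W = W γ`, `W = (Qx, y; QM, Q)` the integer Atkin–Lehner matrix (`N = QM`):
`d_{γ′} ≡ a_γ (mod Q)` and `d_{γ′} ≡ d_γ (mod M)` (rows `(γ′W)₁₀ = (Wγ)₁₀`, `(γ′W)₁₁ = (Wγ)₁₁` divided by `QM`, `Q`). -/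
theorem apply_one_one_of_conj_alWInt {Q M : ℕ} [NeZero Q] [NeZero M] (hN : N = Q * M) (x y : ℤ) (γ γ' : Gamma0 N)
    (hconj : ((γ' : SL(2, ℤ)) : Matrix (Fin 2) (Fin 2) ℤ) * MultOrbit.Wint Q M x y =
      MultOrbit.Wint Q M x y * ((γ : SL(2, ℤ)) : Matrix (Fin 2) (Fin 2) ℤ)) :
    (((γ' : SL(2, ℤ)) 1 1 : ℤ) : ZMod Q) = (((γ : SL(2, ℤ)) 0 0 : ℤ) : ZMod Q) ∧
      (((γ' : SL(2, ℤ)) 1 1 : ℤ) : ZMod M) = (((γ : SL(2, ℤ)) 1 1 : ℤ) : ZMod M) := by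
  have hQ0 : (Q : ℤ) ≠ 0 := by exact_mod_cast NeZero.ne Q
  have hM0 : (M : ℤ) ≠ 0 := by exact_mod_cast NeZero.ne M
  obtain ⟨c₀, hc₀⟩ : (N : ℤ) ∣ (γ : SL(2, ℤ)) 1 0 := (ZMod.intCast_zmod_eq_zero_iff_dvd _ N).mp (Gamma0_mem.mp γ.2)
  obtain ⟨c₁, hc₁⟩ : (N : ℤ) ∣ (γ' : SL(2, ℤ)) 1 0 := (ZMod.intCast_zmod_eq_zero_iff_dvd _ N).mp (Gamma0_mem.mp γ'.2)
  have hNZ : (N : ℤ) = Q * M := by exact_mod_cast hN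
  have e10 := congrArg (fun A : Matrix (Fin 2) (Fin 2) ℤ => A 1 0) hconj
  have e11 := congrArg (fun A : Matrix (Fin 2) (Fin 2) ℤ => A 1 1) hconj
  simp only [MultOrbit.Wint, Matrix.mul_apply, Fin.sum_univ_two, Matrix.of_apply, Matrix.cons_val',
    Matrix.cons_val_zero, Matrix.cons_val_one] at e10 e11
  rw [hc₀, hc₁, hNZ] at e10
  rw [hc₁, hNZ] at e11
  constructor
  · -- `(Q M)·(Q c₁ x + d' − a − Q c₀) = 0`
    have h1 : ((Q : ℤ) * M) * ((Q : ℤ) * c₁ * x + (((γ' : SL(2, ℤ)) 1 1 : ℤ)) - (γ : SL(2, ℤ)) 0 0 - Q * c₀) = 0 := by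
      linear_combination e10
    have h2 : (Q : ℤ) * c₁ * x + (((γ' : SL(2, ℤ)) 1 1 : ℤ)) - (γ : SL(2, ℤ)) 0 0 - Q * c₀ = 0 := by
      rcases mul_eq_zero.mp h1 with h | h
      · exact absurd h (mul_ne_zero hQ0 hM0)
      · exact h
    rw [ZMod.intCast_eq_intCast_iff_dvd_sub]
    exact ⟨c₁ * x - c₀, by linear_combination -h2⟩
  · -- `Q·(M c₁ y + d' − M b − d) = 0`
    have h3 : (Q : ℤ) * ((M : ℤ) * c₁ * y + (((γ' : SL(2, ℤ)) 1 1 : ℤ)) - M * (γ : SL(2, ℤ)) 0 1 - (γ : SL(2, ℤ)) 1 1) = 0 := by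
      linear_combination e11
    have h4 : (M : ℤ) * c₁ * y + (((γ' : SL(2, ℤ)) 1 1 : ℤ)) - M * (γ : SL(2, ℤ)) 0 1 - (γ : SL(2, ℤ)) 1 1 = 0 := by
      rcases mul_eq_zero.mp h3 with h | h
      · exact absurd h hQ0
      · exact h
    rw [ZMod.intCast_eq_intCast_iff_dvd_sub]
    exact ⟨c₁ * y - (γ : SL(2, ℤ)) 0 1, by linear_combination -h4⟩

/-! ### `Γ₀(N)` bookkeeping -/

omit [NeZero N] in
/-- `a_γ d_γ ≡ 1 (mod m)` for `γ ∈ Γ₀(N)` and `m ∣ N`. -/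
theorem gamma0_apply_zero_zero_mul_apply_one_one (γ : Gamma0 N) {m : ℕ} (hm : m ∣ N) :
    ((((γ : SL(2, ℤ)) 0 0 : ℤ) : ZMod m)) * (((γ : SL(2, ℤ)) 1 1 : ℤ) : ZMod m) = 1 := by
  obtain ⟨c₀, hc₀⟩ : (N : ℤ) ∣ (γ : SL(2, ℤ)) 1 0 := (ZMod.intCast_zmod_eq_zero_iff_dvd _ N).mp (Gamma0_mem.mp γ.2)
  have hdet : (γ : SL(2, ℤ)) 0 0 * (γ : SL(2, ℤ)) 1 1 - (γ : SL(2, ℤ)) 0 1 * (γ : SL(2, ℤ)) 1 0 = 1 := by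
    have := Matrix.det_fin_two (γ : SL(2, ℤ)).1
    rw [(γ : SL(2, ℤ)).2] at this
    linear_combination -this
  obtain ⟨n, hn⟩ := hm
  have hNmn : (N : ℤ) = m * n := by exact_mod_cast hn
  have e : (γ : SL(2, ℤ)) 0 0 * (γ : SL(2, ℤ)) 1 1 = 1 + m * (n * (γ : SL(2, ℤ)) 0 1 * c₀) := by
    rw [hc₀, hNmn] at hdet; linear_combination hdet
  have h := congrArg (fun z : ℤ => (z : ZMod m)) e
  push_cast at h
  rw [h, ZMod.natCast_self, zero_mul, add_zero]

omit [NeZero N] in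
/-- `d_{γδ} ≡ d_γ d_δ (mod m)` on `Γ₀(N)`, `m ∣ N`. -/
theorem gamma0_mul_apply_one_one (γ δ : Gamma0 N) {m : ℕ} (hm : m ∣ N) :
    ((((γ * δ : Gamma0 N) : SL(2, ℤ)) 1 1 : ℤ) : ZMod m) =
      (((γ : SL(2, ℤ)) 1 1 : ℤ) : ZMod m) * (((δ : SL(2, ℤ)) 1 1 : ℤ) : ZMod m) := by
  have e : ((γ * δ : Gamma0 N) : SL(2, ℤ)) 1 1 = (γ : SL(2, ℤ)) 1 0 * (δ : SL(2, ℤ)) 0 1 + (γ : SL(2, ℤ)) 1 1 * (δ : SL(2, ℤ)) 1 1 := by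
    change ((γ : SL(2, ℤ)) * (δ : SL(2, ℤ))) 1 1 = _
    simp [Matrix.mul_apply, Fin.sum_univ_two]
  have hcγ : ((((γ : SL(2, ℤ)) 1 0 : ℤ)) : ZMod m) = 0 := by
    rw [ZMod.intCast_zmod_eq_zero_iff_dvd]
    exact (Int.natCast_dvd_natCast.mpr hm).trans ((ZMod.intCast_zmod_eq_zero_iff_dvd _ N).mp (Gamma0_mem.mp γ.2))
  rw [e]; push_cast; rw [hcγ, zero_mul, zero_add]

/-- Casting `d ≡ 1` down a divisor. -/
theorem intCast_eq_one_of_dvd {m m' : ℕ} (h : m' ∣ m) {d : ℤ} (hd : ((d : ZMod m)) = 1) : ((d : ZMod m')) = 1 := by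
  have := congrArg (ZMod.castHom h (ZMod m')) hd
  rwa [map_intCast, map_one] at this

omit [NeZero N] in
/-- Every residue coprime to `N` is `d_γ (mod N)` for some `γ ∈ Γ₀(N)` (Bézout: `γ = (u, −v; N, d)`). -/
theorem exists_gamma0_apply_one_one_eq_int {d : ℤ} (hd : IsCoprime d N) :
    ∃ γ : Gamma0 N, (γ : SL(2, ℤ)) 1 1 = d := by
  obtain ⟨u, v, huv⟩ := hd
  let M : Matrix (Fin 2) (Fin 2) ℤ := !![u, -v; (N : ℤ), d]
  have hdet : M.det = 1 := by rw [Matrix.det_fin_two_of]; linear_combination huv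
  refine ⟨⟨⟨M, hdet⟩, ?_⟩, rfl⟩
  rw [Gamma0_mem]
  show (((N : ℤ)) : ZMod N) = 0
  simp

/-- `ξ(γ) ∈ Λ₁` when `d_γ ≡ 1 (mod N)`. -/
theorem cuspSymbol_mem_of_apply_one_one_eq_one (f : CuspForm (Gamma0 N) 2) (γ : Gamma0 N)
    (h : ((((γ : SL(2, ℤ)) 1 1 : ℤ)) : ZMod N) = 1) : cuspSymbol f γ ∈ periodLatticeGamma1 f := by
  have h' := cuspSymbol_sub_mem_periodLatticeGamma1_of_apply_eq f γ 1 (by rw [h]; simp)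
  rw [cuspSymbol_one, zero_sub] at h'
  simpa using (periodLatticeGamma1 f).neg_mem h'

/-! ### (3) The sign dichotomy at one prime -/

/-- **(3)**: for a prime `q ∣ N`, `Q = q^{v_q(N)}`, `M = N/Q`, `w_Q f = ε f`: if (`ε = 1` and `d_γ ≡ 1 (mod M)`) or (`ε = −1` and
`d_γ ≡ 1 (mod Q)`), then `2 ξ(γ) ∈ Λ₁(f)`. -/
theorem two_mul_cuspSymbol_mem_of_sign (f : CuspForm (Gamma0 N) 2) {q : ℕ} (hq : q.Prime) (hqN : q ∣ N) {ε : ℂ}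
    (hε : atkinLehnerInvolutionAt N 2 q f = ε • f) (γ : Gamma0 N)
    (h : (ε = 1 ∧ ((((γ : SL(2, ℤ)) 1 1 : ℤ)) : ZMod (N / q ^ N.factorization q)) = 1) ∨
      (ε = -1 ∧ ((((γ : SL(2, ℤ)) 1 1 : ℤ)) : ZMod (q ^ N.factorization q)) = 1)) :
    2 * cuspSymbol f γ ∈ periodLatticeGamma1 f := by
  set Q := q ^ N.factorization q with hQdef
  set M := N / q ^ N.factorization q with hMdef
  haveI : NeZero Q := ⟨(Nat.ordProj_pos N q).ne'⟩
  obtain ⟨hQN, hcQ⟩ := ordProj_dvd_and_coprime N (Nat.mem_primeFactors.mpr ⟨hq, hqN, NeZero.ne N⟩)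
  have hNQM : N = Q * M := (Nat.mul_div_cancel' hQN).symm
  haveI : NeZero M := ⟨fun h0 => NeZero.ne N (by rw [hNQM, h0, mul_zero])⟩
  have hε' : atkinLehnerInvolution N 2 Q f = ε • f := by rwa [atkinLehnerInvolutionAt_eq (N := N) (k := 2) rfl] at hε
  obtain ⟨γ', hconj⟩ := MultAL.exists_conj_alWInt hQN hcQ γ
  have hξ : cuspSymbol f γ' = ε * cuspSymbol f γ := MultAL.cuspSymbol_eq_mul_of_conj_alWInt hQN hcQ hε' γ γ' hconj
  have hMQ : N / Q = M := rfl
  rw [hMQ] at hconj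
  obtain ⟨hdQ, hdM⟩ := apply_one_one_of_conj_alWInt hNQM _ _ γ γ' hconj
  -- CRT glue: equal mod `Q` and mod `M` ⟹ equal mod `N`
  have crt : ∀ s t : ℤ, ((s : ZMod Q) = t) → ((s : ZMod M) = t) → ((s : ZMod N) = t) := by
    intro s t h1 h2
    rw [ZMod.intCast_eq_intCast_iff_dvd_sub] at h1 h2 ⊢
    rw [hNQM, Nat.cast_mul]
    exact (Nat.isCoprime_iff_coprime.mpr hcQ).mul_dvd h1 h2
  rcases h with ⟨rfl, h1⟩ | ⟨rfl, h1⟩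
  · -- `d' ≡ a (mod N)`: mod Q from Atkin–Li, mod M since `a ≡ d⁻¹ ≡ 1 ≡ d'`... precisely `d' ≡ d ≡ 1` and `a ≡ 1 (mod M)`
    have haM : ((((γ : SL(2, ℤ)) 0 0 : ℤ)) : ZMod M) = 1 := by
      have hadM := gamma0_apply_zero_zero_mul_apply_one_one γ (show M ∣ N from ⟨Q, by rw [hNQM, mul_comm]⟩)
      rwa [h1, mul_one] at hadM
    have hd'a : ((((γ' : SL(2, ℤ)) 1 1 : ℤ)) : ZMod N) = (((γ : SL(2, ℤ)) 0 0 : ℤ) : ZMod N) :=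
      crt _ _ hdQ (by rw [hdM, h1, haM])
    -- so `ξ(γ') ≡ ξ(γ⁻¹) = −ξ(γ)` mod Λ₁
    have hinv11 : ((γ⁻¹ : Gamma0 N) : SL(2, ℤ)) 1 1 = (γ : SL(2, ℤ)) 0 0 := by
      rw [InvMemClass.coe_inv, Matrix.SpecialLinearGroup.SL2_inv_expl]; rfl
    have hsub := cuspSymbol_sub_mem_periodLatticeGamma1_of_apply_eq f γ' γ⁻¹ (by rw [hinv11, hd'a])
    have hinv : cuspSymbol f γ⁻¹ = -cuspSymbol f γ := by
      have := cuspSymbol_mul_holds f γ⁻¹ γ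
      rw [inv_mul_cancel, cuspSymbol_one] at this
      linear_combination -this
    rw [hinv, hξ, one_mul] at hsub
    have : 2 * cuspSymbol f γ = -(-cuspSymbol f γ - cuspSymbol f γ) := by ring
    rw [this]
    exact (periodLatticeGamma1 f).neg_mem hsub
  · -- `d' ≡ d (mod N)`: mod M from Atkin–Li, mod Q since `a ≡ d⁻¹ ≡ 1 ≡ d`
    have haQ : ((((γ : SL(2, ℤ)) 0 0 : ℤ)) : ZMod Q) = 1 := by
      have hadQ := gamma0_apply_zero_zero_mul_apply_one_one γ hQN
      rwa [h1, mul_one] at hadQ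
    have hd'd : ((((γ' : SL(2, ℤ)) 1 1 : ℤ)) : ZMod N) = (((γ : SL(2, ℤ)) 1 1 : ℤ) : ZMod N) :=
      crt _ _ (by rw [hdQ, haQ, h1]) hdM
    have hsub := cuspSymbol_sub_mem_periodLatticeGamma1_of_apply_eq f γ' γ (by rw [hd'd])
    rw [hξ] at hsub
    have : 2 * cuspSymbol f γ = cuspSymbol f γ - (-1) * cuspSymbol f γ := by ring
    rw [this]
    exact hsub

/-! ### (4) CRT induction over the prime factors -/

/-- **(4)**: if `2ξ(γ) ∈ Λ₁` for every prime `q ∣ N` and every `γ ∈ Γ₀(N)` with `d_γ ≡ 1 (mod N/Q_q)`, then `2ξ(γ) ∈ Λ₁` for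
every `γ ∈ Γ₀(N)`. -/
theorem two_mul_cuspSymbol_mem_of_components (f : CuspForm (Gamma0 N) 2)
    (h : ∀ q ∈ N.primeFactors, ∀ γ : Gamma0 N,
      ((((γ : SL(2, ℤ)) 1 1 : ℤ)) : ZMod (N / q ^ N.factorization q)) = 1 → 2 * cuspSymbol f γ ∈ periodLatticeGamma1 f)
    (γ : Gamma0 N) : 2 * cuspSymbol f γ ∈ periodLatticeGamma1 f := by
  -- `P(T)`: every `γ` with `d_γ ≡ 1 (mod Q_q)` for all `q ∉ T` has `2ξ(γ) ∈ Λ₁`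
  suffices hP : ∀ T : Finset ℕ, T ⊆ N.primeFactors → ∀ γ : Gamma0 N,
      (∀ q ∈ N.primeFactors, q ∉ T → ((((γ : SL(2, ℤ)) 1 1 : ℤ)) : ZMod (q ^ N.factorization q)) = 1) →
      2 * cuspSymbol f γ ∈ periodLatticeGamma1 f by
    exact hP N.primeFactors le_rfl γ (fun q hq hq' => absurd hq hq')
  intro T
  induction T using Finset.induction_on with
  | empty =>
    intro _ γ hγ
    -- `d ≡ 1 (mod Q_q)` for all `q` ⟹ `d ≡ 1 (mod N)`
    have hd : ((((γ : SL(2, ℤ)) 1 1 : ℤ)) : ZMod N) = 1 := by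
      rw [show (1 : ZMod N) = ((1 : ℤ) : ZMod N) by simp, ZMod.intCast_eq_intCast_iff_dvd_sub]
      have hprod : (N : ℤ) = ∏ q ∈ N.primeFactors, ((q ^ N.factorization q : ℕ) : ℤ) := by
        rw [← Nat.cast_prod, ← Nat.prod_factorization_eq_prod_primeFactors, Nat.prod_factorization_pow_eq_self (NeZero.ne N)]
      rw [hprod]
      refine Finset.prod_dvd_of_coprime ?_ fun q hq => ?_
      · intro a ha b hb hab
        exact Nat.isCoprime_iff_coprime.mpr (Nat.coprime_pow_primes _ _ (Nat.prime_of_mem_primeFactors ha)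
          (Nat.prime_of_mem_primeFactors hb) hab)
      · have := hγ q hq (Finset.notMem_empty q)
        rw [show (1 : ZMod (q ^ N.factorization q)) = ((1 : ℤ) : ZMod _) by simp, ZMod.intCast_eq_intCast_iff_dvd_sub] at this
        exact this
    have hmem := cuspSymbol_mem_of_apply_one_one_eq_one f γ hd
    simpa [two_mul] using (periodLatticeGamma1 f).add_mem hmem hmem
  | insert q₀ T hq₀T ih =>
    intro hsub γ hγ
    have hq₀ : q₀ ∈ N.primeFactors := hsub (Finset.mem_insert_self q₀ T)
    have hq₀p : q₀.Prime := Nat.prime_of_mem_primeFactors hq₀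
    set Q := q₀ ^ N.factorization q₀ with hQdef
    set M := N / q₀ ^ N.factorization q₀ with hMdef
    haveI : NeZero Q := ⟨(Nat.ordProj_pos N q₀).ne'⟩
    obtain ⟨hQN, hcQ⟩ := ordProj_dvd_and_coprime N hq₀
    have hNQM : N = Q * M := (Nat.mul_div_cancel' hQN).symm
    haveI : NeZero M := ⟨fun h0 => NeZero.ne N (by rw [hNQM, h0, mul_zero])⟩
    have hMN : M ∣ N := ⟨Q, by rw [hNQM, mul_comm]⟩
    -- CRT: `k ≡ d (mod Q)`, `k ≡ 1 (mod M)`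
    set d : ℤ := ((γ : SL(2, ℤ)) 1 1 : ℤ) with hddef
    obtain ⟨k, hkQ, hkM⟩ := Nat.chineseRemainder hcQ ((d : ZMod Q).val) 1
    have hkQ' : ((k : ℤ) : ZMod Q) = (d : ZMod Q) := by
      have h1 : ((k : ℕ) : ZMod Q) = (((d : ZMod Q).val : ℕ) : ZMod Q) := (ZMod.natCast_eq_natCast_iff' _ _ _).mpr hkQ
      rw [ZMod.natCast_zmod_val] at h1
      exact_mod_cast h1
    have hkM' : ((k : ℤ) : ZMod M) = 1 := by
      have h1 : ((k : ℕ) : ZMod M) = ((1 : ℕ) : ZMod M) := (ZMod.natCast_eq_natCast_iff' _ _ _).mpr hkM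
      rw [Nat.cast_one] at h1
      exact_mod_cast h1
    -- `k` is coprime to `N = Q M`
    have hkcop : IsCoprime (k : ℤ) N := by
      refine Nat.isCoprime_iff_coprime.mpr ?_
      rw [hNQM]
      refine Nat.Coprime.mul_right ?_ ?_
      · refine (ZMod.isUnit_iff_coprime k Q).mp ?_
        have hu : IsUnit ((d : ZMod Q)) :=
          IsUnit.of_mul_eq_one_right _ (gamma0_apply_zero_zero_mul_apply_one_one γ hQN)
        have e : ((k : ℕ) : ZMod Q) = (d : ZMod Q) := by exact_mod_cast hkQ'
        rwa [e]
      · refine (ZMod.isUnit_iff_coprime k M).mp ?_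
        have e : ((k : ℕ) : ZMod M) = 1 := by exact_mod_cast hkM'
        rw [e]; exact isUnit_one
    obtain ⟨γ₀, hγ₀⟩ := exists_gamma0_apply_one_one_eq_int (N := N) hkcop
    -- `γ₀ ∈ K_{q₀}`: `2ξ(γ₀) ∈ Λ₁`
    have h₀ : 2 * cuspSymbol f γ₀ ∈ periodLatticeGamma1 f := h q₀ hq₀ γ₀ (by rw [hγ₀]; exact hkM')
    -- `δ = γ₀⁻¹ γ` satisfies the induction hypothesis
    set δ : Gamma0 N := γ₀⁻¹ * γ with hδdef
    have hδ : ∀ q ∈ N.primeFactors, q ∉ T → ((((δ : SL(2, ℤ)) 1 1 : ℤ)) : ZMod (q ^ N.factorization q)) = 1 := by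
      intro q hq hqT
      have hQq : q ^ N.factorization q ∣ N := Nat.ordProj_dvd N q
      have hinv11 : ((γ₀⁻¹ : Gamma0 N) : SL(2, ℤ)) 1 1 = (γ₀ : SL(2, ℤ)) 0 0 := by
        rw [InvMemClass.coe_inv, Matrix.SpecialLinearGroup.SL2_inv_expl]; rfl
      rw [hδdef, gamma0_mul_apply_one_one _ _ hQq, hinv11]
      have had₀ := gamma0_apply_zero_zero_mul_apply_one_one γ₀ hQq
      rw [hγ₀] at had₀
      by_cases hqq : q = q₀
      · subst hqq
        rw [← hkQ']
        exact had₀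
      · -- `Q_q ∣ M`, so `k ≡ 1 (mod Q_q)` and `d ≡ 1 (mod Q_q)`
        have hqM : q ^ N.factorization q ∣ M := by
          have hcop : Nat.Coprime (q ^ N.factorization q) Q :=
            Nat.coprime_pow_primes _ _ (Nat.prime_of_mem_primeFactors hq) hq₀p hqq
          exact hcop.dvd_of_dvd_mul_left (hNQM ▸ hQq)
        have hk1 : ((k : ℤ) : ZMod (q ^ N.factorization q)) = 1 := intCast_eq_one_of_dvd hqM hkM'
        have hd1 := hγ q hq (fun hmem => by rcases Finset.mem_insert.mp hmem with h' | h'; exacts [hqq h', hqT h'])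
        rw [hk1, mul_one] at had₀
        rw [had₀, one_mul, hd1]
    have hδmem := ih ((Finset.subset_insert q₀ T).trans hsub) δ hδ
    have hγδ : γ = γ₀ * δ := by rw [hδdef, mul_inv_cancel_left]
    rw [hγδ, cuspSymbol_mul_holds f γ₀ δ, mul_add]
    exact (periodLatticeGamma1 f).add_mem h₀ hδmem

/-! ### (5) THEOREM AL -/

omit [NeZero N] in
/-- `2Λ₀(f) ⊆ Λ₁(f)` once `2ξ(γ) ∈ Λ₁(f)` for every `γ`. -/
theorem two_mul_mem_periodLatticeGamma1_of_forall (f : CuspForm (Gamma0 N) 2)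
    (h : ∀ γ : Gamma0 N, 2 * cuspSymbol f γ ∈ periodLatticeGamma1 f) {x : ℂ} (hx : x ∈ periodLattice f) :
    2 * x ∈ periodLatticeGamma1 f := by
  induction hx using AddSubgroup.closure_induction with
  | mem z hz =>
    obtain ⟨γ, rfl⟩ := hz
    exact h γ
  | zero => simp
  | add a b _ _ ha hb => rw [mul_add]; exact (periodLatticeGamma1 f).add_mem ha hb
  | neg a _ ha => rw [mul_neg]; exact (periodLatticeGamma1 f).neg_mem ha

/-- **E-es-71 `AtkinLehnerShimuraSignLaw` IS A THEOREM** (es g20 THEOREM AL): for a newform `f` on `Γ₀(N)` and an odd prime `p`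
dividing the Shimura index `[Λ₀(f) : Λ₁(f)]`, exactly one prime `q ∣ N` has Atkin–Lehner sign `ε_{Q_q}(f) = −1`.
BSD is not proved by this. -/
theorem atkinLehnerShimuraSignLaw_holds : AtkinLehnerShimuraSignLaw := by
  intro N _ f hf p hp hp2 hnot
  have hsign : ∀ q : ℕ, q.Prime → q ∣ N →
      (atkinLehnerEigenvalueAt f q = 1 ∨ atkinLehnerEigenvalueAt f q = -1) ∧
        atkinLehnerInvolutionAt N 2 q f = atkinLehnerEigenvalueAt f q • f := by
    intro q hq hqN
    obtain ⟨ε, hε, hw⟩ := IsNewform0.exists_atkinLehnerInvolutionAt_eq_smul_holds hf hq hqN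
    rw [atkinLehnerEigenvalueAt_eq_of_eq_smul hf.ne_zero hw]
    exact ⟨hε, hw⟩
  by_contra hne
  -- (3) at every prime factor
  have hcomp : ∀ q ∈ N.primeFactors, ∀ γ : Gamma0 N,
      ((((γ : SL(2, ℤ)) 1 1 : ℤ)) : ZMod (N / q ^ N.factorization q)) = 1 →
        2 * cuspSymbol f γ ∈ periodLatticeGamma1 f := by
    intro q hq γ hγ
    have hqp : q.Prime := Nat.prime_of_mem_primeFactors hq
    have hqN : q ∣ N := Nat.dvd_of_mem_primeFactors hq
    obtain ⟨hε, hw⟩ := hsign q hqp hqN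
    rcases hε with h1 | h1
    · rw [h1] at hw
      exact two_mul_cuspSymbol_mem_of_sign f hqp hqN hw γ (Or.inl ⟨rfl, hγ⟩)
    · by_cases hex : ∃ q' : ℕ, q'.Prime ∧ q' ∣ N ∧ atkinLehnerEigenvalueAt f q' = -1 ∧ q' ≠ q
      · obtain ⟨q', hq'p, hq'N, hq'ε, hq'q⟩ := hex
        obtain ⟨-, hw'⟩ := hsign q' hq'p hq'N
        rw [hq'ε] at hw'
        refine two_mul_cuspSymbol_mem_of_sign f hq'p hq'N hw' γ (Or.inr ⟨rfl, ?_⟩)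
        -- `Q_{q'} ∣ N / Q_q`
        have hQq : q ^ N.factorization q ∣ N := Nat.ordProj_dvd N q
        have hNQM : N = q ^ N.factorization q * (N / q ^ N.factorization q) := (Nat.mul_div_cancel' hQq).symm
        have hcop : Nat.Coprime (q' ^ N.factorization q') (q ^ N.factorization q) :=
          Nat.coprime_pow_primes _ _ hq'p hqp hq'q
        have hdvd : q' ^ N.factorization q' ∣ N / q ^ N.factorization q :=
          hcop.dvd_of_dvd_mul_left (hNQM ▸ Nat.ordProj_dvd N q')
        exact intCast_eq_one_of_dvd hdvd hγ
      · exact absurd ⟨q, ⟨hqp, hqN, h1⟩, fun q' hq' => by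
          by_contra hq'q
          exact hex ⟨q', hq'.1, hq'.2.1, hq'.2.2, hq'q⟩⟩ hne
  have hall := two_mul_cuspSymbol_mem_of_components f hcomp
  -- contradiction: `x ∈ Λ₀ ∖ Λ₁` with `p x ∈ Λ₁` and `2 x ∈ Λ₁`, `p` odd
  apply hnot
  intro x hx hpx
  have h2x := two_mul_mem_periodLatticeGamma1_of_forall f hall hx
  have hcop : Nat.Coprime 2 p := (Nat.coprime_primes Nat.prime_two hp).mpr (Ne.symm hp2)
  obtain ⟨a, b, hab⟩ : ∃ a b : ℤ, a * ((2 : ℕ) : ℤ) + b * (p : ℤ) = 1 := Nat.isCoprime_iff_coprime.mpr hcop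
  have habC : (a : ℂ) * 2 + (b : ℂ) * (p : ℂ) = 1 := by exact_mod_cast hab
  have e : x = a • (2 * x) + b • ((p : ℂ) * x) := by
    simp only [zsmul_eq_mul]
    linear_combination -(habC) * x
  rw [e]
  exact (periodLatticeGamma1 f).add_mem ((periodLatticeGamma1 f).zsmul_mem h2x a)
    ((periodLatticeGamma1 f).zsmul_mem hpx b)

end Summit.BirchSwinnertonDyer.BirchSwinnertonDyer.Theorems.ManinLocalTwoThree

end
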